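import Mathlib
import Literature.Combinatorics.Optimization.DeKlerkPasechnikThetaDual
import HarnessLib

/-!
# The `ϑ`-rank of a graph, the de Klerk–Pasechnik conjecture, and `ϑ^{(1)}(C₅) = 2 = α(C₅)`

For the de Klerk–Pasechnik hierarchy `ϑ^{(r)}(G)` (`DeKlerkPasechnikTheta.theta G r`) the
**`ϑ`-rank** of `G` is the least `r` with `ϑ^{(r)}(G) = α(G)` [cite: LaurentVargas2022, §1
("the smallest integer r for which ϑ^{(r)}(G) = α(G) … denoted rank(G)")]; **Conjecture 1 of
de Klerk and Pasechnik** asserts `ϑ^{(α(G)-1)}(G) = α(G)`, i.e. `rank(G) ≤ α(G) - 1`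
[cite: LaurentVargas2022, §1 (Conjecture 1)] [cite: DeklerkPasechnik2002], and Conjecture 2 that the
rank is finite. This file records these notions and proves the first nontrivial instance: the
pentagon has `ϑ`-rank exactly `1` [cite: LaurentVargas2022, §1 ("the cycle C_5 has α(C_5) = 2 and
rank(C_5) = 1"; "odd cycles and wheels have ϑ-rank 1" [dKP2002])], via Parrilo's sum-of-squares
certificate for the Horn form [cite: Laurent2008, Example 3.23] in the form
`2(I + A_{C₅}) - J ∈ K^{(1)}_5` [cite: Gvozdenovic2008, Example 4.2.14].

## Main statements

* `inParriloCone_one_of_row_certificate`: the **row certificate** for `K^{(1)}_n` — the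
  Gvozdenović–Laurent / Bomze–de Klerk sufficient condition [cite: Gvozdenovic2008, Lemma 4.2.3 and
  Theorem 4.2.2] (`inParriloCone_succ_of_decomposition` of `ParriloCopositiveSos`) with the choice
  `M⁽ⁱ⁾ := M - Mᵢ Mᵢᵀ` (`Mᵢ` the `i`-th row): if
  `M_{jk} + M_{ik} + M_{ij} ≥ M_{ij}M_{ik} + M_{ji}M_{jk} + M_{ki}M_{kj}` for all `i, j, k`, then
  `M ∈ K^{(1)}_n`; as a polynomial identity this is
  `(∑ᵢ xᵢ²)·P_M(x) = ∑ᵢ xᵢ² ((M x^{∘2})ᵢ)² + (a form with nonnegative coefficients)`.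
* `parriloCertificate_cycleGraph_five`: for `H = 2(I + A_{C₅}) - J` (the Horn matrix, up to the
  relabelling `i ↦ 2i`), Parrilo's identity
  `(∑ xᵢ²)·P_H(x) = ∑ₘ xₘ² ((H x^{∘2})ₘ)² + 4 ∑ₘ x²ₘ₋₁ x²ₘ x²ₘ₊₁` [cite: Laurent2008, Example 3.23];
  hence `inParriloCone_one_dkpMatrix_cycleGraph_five : 2(I + A_{C₅}) - J ∈ K^{(1)}_5`
  [cite: Gvozdenovic2008, Example 4.2.14], while `2(I + A_{C₅}) - J ∉ K^{(0)}_5`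
  (`DeKlerkPasechnikTheta.not_inParriloCone_zero_dkpMatrix_cycleGraph_five`).
* `theta_one_cycleGraph_five : ϑ^{(1)}(C₅) = 2 = α(C₅)` and `theta_cycleGraph_five_of_pos`
  (`ϑ^{(r)}(C₅) = 2` for all `r ≥ 1`), whereas `ϑ^{(0)}(C₅) > 2`
  (`DeKlerkPasechnikThetaDual.indepNum_lt_theta_zero_cycleGraph_five`; in fact `ϑ^{(0)}(C₅) = √5`).
* `thetaRank`, `theta_eq_indepNum_of_le` (once exact, the hierarchy stays exact),
  `thetaRank_eq_zero_of_colorable` (`α(G) = χ(Ḡ)` gives rank `0`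
  [cite: LaurentVargas2022, §1]), **`thetaRank_cycleGraph_five : rank(C₅) = 1`**.
* The identity `ϑ^{(α(G)-1)}(G) = α(G)` predicted by Conjecture 1, proved in the two cases at
  hand: `theta_indepNum_pred_of_colorable` (`α(G) = χ(Ḡ)`) and
  **`theta_indepNum_pred_cycleGraph_five`** (the pentagon, where it is tight:
  `thetaRank_cycleGraph_five_eq_indepNum_pred`). (Conjecture 1 itself is not stated as a
  declaration here.)

## Not treated

The Bomze–de Klerk converse (necessity of the decomposition for `K^{(1)}`), general odd cycles
and wheels, the icosahedron complement (`rank = 2`), and the results `rank(G) ≤ α(G) - 1` for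
`α(G) ≤ 8` [cite: Gvozdenovic2008, Theorem 4.2.13].
-/

noncomputable section

namespace Literature.Combinatorics.Optimization.DeKlerkPasechnikThetaRank

open Matrix Finset SimpleGraph
open Literature.Algebra.Polynomial.ParriloCopositiveSos
open Literature.Combinatorics.Optimization.MotzkinStrausCopositive
open Literature.Combinatorics.Optimization.DeKlerkPasechnikTheta
open Literature.Combinatorics.Optimization.DeKlerkPasechnikThetaDual

variable {V : Type*} [Fintype V] [DecidableEq V] (G : SimpleGraph V) [DecidableRel G.Adj]

/-! ## The row certificate for `K^{(1)}_n` -/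

section RowCertificate

omit [Fintype V] in
/-- Entries of `t(I + A_G) - J`. [folklore] -/
@[folklore] private theorem dkpMatrix_apply' (t : ℝ) (i j : V) :
    dkpMatrix G t i j = t * ((if i = j then 1 else 0) + if G.Adj i j then 1 else 0) - 1 := by
  simp only [dkpMatrix, msMatrix, onesMatrix, Matrix.sub_apply, Matrix.smul_apply, Matrix.add_apply,
    Matrix.one_apply, SimpleGraph.adjMatrix_apply, Matrix.of_apply, smul_eq_mul]

omit [DecidableEq V] in
/-- A rank-one matrix `a aᵀ` is positive semidefinite: `xᵀ(a aᵀ)x = (aᵀx)²`. [folklore] -/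
@[folklore] private theorem posSemidef_vecMulVec_self (a : V → ℝ) : (vecMulVec a a).PosSemidef := by
  refine PosSemidef.of_dotProduct_mulVec_nonneg ?_ fun x => ?_
  · ext i j
    simp [vecMulVec_apply, mul_comm]
  · have h : star x ⬝ᵥ (vecMulVec a a *ᵥ x) = (∑ i, a i * x i) * ∑ j, a j * x j := by
      rw [Finset.sum_mul_sum]
      simp only [dotProduct, mulVec, vecMulVec_apply, star_trivial, Finset.mul_sum]
      exact Finset.sum_congr rfl fun i _ => Finset.sum_congr rfl fun j _ => by ring
    rw [h]
    exact mul_self_nonneg _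

/-- **The row certificate for `K^{(1)}_n`.** In the Gvozdenović–Laurent sufficient condition for
`K^{(t+1)}_n` [cite: Gvozdenovic2008, Lemma 4.2.3] (for `t = 0` the sufficiency half of the
Bomze–de Klerk characterisation of `K^{(1)}_n` [cite: Gvozdenovic2008, Theorem 4.2.2]) take
`M⁽ⁱ⁾ := M - Mᵢ Mᵢᵀ`, so that `M - M⁽ⁱ⁾ = Mᵢ Mᵢᵀ ⪰ 0` lies in `K^{(0)}_n`; the remaining condition
`M⁽ⁱ⁾_{jk} + M⁽ʲ⁾_{ik} + M⁽ᵏ⁾_{ij} ≥ 0` reads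
`M_{jk} + M_{ik} + M_{ij} ≥ M_{ij}M_{ik} + M_{ji}M_{jk} + M_{ki}M_{kj}`. Equivalently,
`(∑ᵢ xᵢ²) P_M(x) = ∑ᵢ (xᵢ (M x^{∘2})ᵢ)² + (even sextic with nonnegative coefficients)` — the shape of
Parrilo's certificate for the Horn form [cite: Laurent2008, Example 3.23]. -/
theorem inParriloCone_one_of_row_certificate {M : Matrix V V ℝ}
    (h : ∀ i j k, 0 ≤ (M j k - M i j * M i k) + (M i k - M j i * M j k) + (M i j - M k i * M k j)) :
    InParriloCone 1 M := by
  refine inParriloCone_succ_of_decomposition (t := 0) (fun i => M - vecMulVec (M i) (M i))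
    (fun i => ?_) (fun i j k => ?_)
  · rw [sub_sub_cancel]
    exact inParriloCone_zero_of_posSemidef (posSemidef_vecMulVec_self (M i))
  · simpa [Matrix.sub_apply, vecMulVec_apply] using h i j k

end RowCertificate

/-! ## The pentagon at order 1 -/

section Pentagon

/-- `2(I + A_{C₅}) - J`: `+1` on the diagonal and on the edges `{i, i ± 1}`, `-1` on the non-edges
`{i, i ± 2}` (the Horn matrix after relabelling `i ↦ 2i`). [folklore] -/
@[folklore] private theorem dkpMatrix_cycleGraph_five_two : dkpMatrix (cycleGraph 5) 2 =
    !![1, 1, -1, -1, 1; 1, 1, 1, -1, -1; -1, 1, 1, 1, -1; -1, -1, 1, 1, 1; 1, -1, -1, 1, 1] := by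
  ext i j
  rw [dkpMatrix_apply']
  fin_cases i <;> fin_cases j <;> simp +decide <;> norm_num

/-- **Parrilo's certificate for the pentagon / Horn form** [cite: Laurent2008, Example 3.23 ("Parrilo
proved that, while p_M is not a SOS, (∑ᵢ xᵢ²) p_M is a SOS")] [cite: Gvozdenovic2008, Example 4.2.14]:
with `H = 2(I + A_{C₅}) - J`,
`(∑ᵢ xᵢ²) · ∑_{ij} H_{ij} xᵢ² xⱼ² = ∑ₘ xₘ² (∑ⱼ H_{mj} xⱼ²)² + 4 ∑ₘ x²ₘ₋₁ x²ₘ x²ₘ₊₁` — an explicit sum of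
the squares `(xₘ (H x^{∘2})ₘ)²` and `(2 xₘ₋₁ xₘ xₘ₊₁)²`. -/
theorem parriloCertificate_cycleGraph_five (x : Fin 5 → ℝ) :
    (∑ i, x i ^ 2) * (∑ i, ∑ j, dkpMatrix (cycleGraph 5) 2 i j * x i ^ 2 * x j ^ 2) =
      (∑ m, x m ^ 2 * (∑ j, dkpMatrix (cycleGraph 5) 2 m j * x j ^ 2) ^ 2) +
        4 * (x 4 ^ 2 * x 0 ^ 2 * x 1 ^ 2 + x 0 ^ 2 * x 1 ^ 2 * x 2 ^ 2 + x 1 ^ 2 * x 2 ^ 2 * x 3 ^ 2 +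
          x 2 ^ 2 * x 3 ^ 2 * x 4 ^ 2 + x 3 ^ 2 * x 4 ^ 2 * x 0 ^ 2) := by
  rw [dkpMatrix_cycleGraph_five_two]
  simp [Fin.sum_univ_five]
  ring

/-- The same identity phrased with `ParriloCopositiveSos.evenForm` (`P_H = evenForm H` evaluated):
`(∑ xᵢ²) · P_H(x) ≥ ∑ₘ xₘ² ((H x^{∘2})ₘ)²` pointwise [cite: Laurent2008, Example 3.23]. -/
theorem sumSq_mul_eval_evenForm_cycleGraph_five_ge (x : Fin 5 → ℝ) :
    (∑ m, x m ^ 2 * (∑ j, dkpMatrix (cycleGraph 5) 2 m j * x j ^ 2) ^ 2) ≤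
      (∑ i, x i ^ 2) * MvPolynomial.eval x (evenForm (dkpMatrix (cycleGraph 5) 2)) := by
  rw [eval_evenForm, parriloCertificate_cycleGraph_five]
  have : 0 ≤ 4 * (x 4 ^ 2 * x 0 ^ 2 * x 1 ^ 2 + x 0 ^ 2 * x 1 ^ 2 * x 2 ^ 2 +
      x 1 ^ 2 * x 2 ^ 2 * x 3 ^ 2 + x 2 ^ 2 * x 3 ^ 2 * x 4 ^ 2 + x 3 ^ 2 * x 4 ^ 2 * x 0 ^ 2) := by
    positivity
  linarith

/-- **`2(I + A_{C₅}) - J ∈ K^{(1)}_5`** [cite: Gvozdenovic2008, Example 4.2.14 ("For G := C_5, the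
matrix 2(I + A_G) - J is in K^{(1)}_5")] [cite: Laurent2008, Example 3.23] — by the row certificate:
the `125` conditions evaluate to `0` or `2`. (It is not in `K^{(0)}_5`:
`DeKlerkPasechnikTheta.not_inParriloCone_zero_dkpMatrix_cycleGraph_five`.) -/
theorem inParriloCone_one_dkpMatrix_cycleGraph_five : InParriloCone 1 (dkpMatrix (cycleGraph 5) 2) := by
  rw [dkpMatrix_cycleGraph_five_two]
  refine inParriloCone_one_of_row_certificate fun i j k => ?_
  fin_cases i <;> fin_cases j <;> fin_cases k <;> simp <;> norm_num

/-- **`ϑ^{(1)}(C₅) ≤ 2`** [cite: Gvozdenovic2008, Example 4.2.14] [cite: LaurentVargas2022, §1]. -/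
theorem theta_one_cycleGraph_five_le : theta (cycleGraph 5) 1 ≤ 2 :=
  theta_le_of_inParriloCone (cycleGraph 5) inParriloCone_one_dkpMatrix_cycleGraph_five

/-- **`ϑ^{(1)}(C₅) = 2 = α(C₅)`**: the hierarchy is exact for the pentagon at order `1`
[cite: LaurentVargas2022, §1 ("the cycle C_5 has α(C_5) = 2 and rank(C_5) = 1")]
[cite: DeklerkPasechnik2002]. -/
theorem theta_one_cycleGraph_five : theta (cycleGraph 5) 1 = 2 := by
  refine le_antisymm theta_one_cycleGraph_five_le ?_
  have h := indepNum_le_theta (cycleGraph 5) 1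
  rw [indepNum_cycleGraph_five] at h
  exact_mod_cast h

/-- **`ϑ^{(r)}(C₅) = 2` for every `r ≥ 1`** (antitonicity in `r` and `α ≤ ϑ^{(r)}`)
[cite: LaurentVargas2022, §1]. -/
theorem theta_cycleGraph_five_of_pos {r : ℕ} (hr : 1 ≤ r) : theta (cycleGraph 5) r = 2 := by
  refine le_antisymm ((theta_anti (cycleGraph 5) hr).trans theta_one_cycleGraph_five.le) ?_
  have h := indepNum_le_theta (cycleGraph 5) r
  rw [indepNum_cycleGraph_five] at h
  exact_mod_cast h

/-- `ϑ^{(r)}(C₅) = α(C₅)` for `r ≥ 1` [cite: LaurentVargas2022, §1]. -/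
theorem theta_cycleGraph_five_eq_indepNum {r : ℕ} (hr : 1 ≤ r) :
    theta (cycleGraph 5) r = (cycleGraph 5).indepNum := by
  rw [theta_cycleGraph_five_of_pos hr, indepNum_cycleGraph_five]
  norm_num

end Pentagon

/-! ## The `ϑ`-rank and the de Klerk–Pasechnik conjecture -/

section Rank

/-- **The `ϑ`-rank of `G`**: the least `r` with `ϑ^{(r)}(G) = α(G)` (and `0` if there is none —
Conjecture 2 of [cite: LaurentVargas2022, §1] says there always is one)
[cite: LaurentVargas2022, §1 ("the smallest integer r for which ϑ^{(r)}(G) = α(G) the ϑ-rank")]. -/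
def thetaRank : ℕ := sInf {r : ℕ | theta G r = G.indepNum}

/-- **Once exact, always exact**: if `ϑ^{(r₀)}(G) = α(G)` then `ϑ^{(r)}(G) = α(G)` for all `r ≥ r₀`
(`α(G) ≤ ϑ^{(r)}(G) ≤ ϑ^{(r₀)}(G)`) [cite: LaurentVargas2022, §1 ((1.3)–(1.4))]. -/
theorem theta_eq_indepNum_of_le [Nonempty V] {r₀ r : ℕ} (h₀ : theta G r₀ = G.indepNum) (h : r₀ ≤ r) :
    theta G r = G.indepNum :=
  le_antisymm ((theta_anti G h).trans h₀.le) (indepNum_le_theta G r)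

/-- If `ϑ^{(r)}(G) = α(G)` then `rank(G) ≤ r` [cite: LaurentVargas2022, §1 (definition of the
rank)]. -/
theorem thetaRank_le_of_eq {r : ℕ} (h : theta G r = G.indepNum) : thetaRank G ≤ r :=
  Nat.sInf_le h

/-- If some level is exact, the level `rank(G)` is exact
[cite: LaurentVargas2022, §1 (definition of the rank)]. -/
theorem theta_thetaRank_eq {r : ℕ} (h : theta G r = G.indepNum) :
    theta G (thetaRank G) = G.indepNum :=
  Nat.sInf_mem (s := {r : ℕ | theta G r = G.indepNum}) ⟨r, h⟩

/-- **`α(G) = χ(Ḡ)` gives `ϑ`-rank `0`** (e.g. perfect graphs)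
[cite: LaurentVargas2022, §1 ("if α(G) = χ(Ḡ) then ϑ^{(0)}(G) = α(G) and thus G has rank 0")]. -/
theorem thetaRank_eq_zero_of_colorable [Nonempty V] (hc : Gᶜ.Colorable G.indepNum) :
    thetaRank G = 0 :=
  Nat.eq_zero_of_le_zero (thetaRank_le_of_eq G (theta_eq_indepNum_of_colorable G hc 0))

/-- **`rank(C₅) = 1`** [cite: LaurentVargas2022, §1 ("the cycle C_5 has α(C_5) = 2 and
rank(C_5) = 1"; "odd cycles and wheels have ϑ-rank 1 [dKP2002]")] [cite: DeklerkPasechnik2002]: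
`ϑ^{(1)}(C₅) = 2` while `ϑ^{(0)}(C₅) > 2`. -/
theorem thetaRank_cycleGraph_five : thetaRank (cycleGraph 5) = 1 := by
  have h1 : (1 : ℕ) ∈ {r : ℕ | theta (cycleGraph 5) r = (cycleGraph 5).indepNum} :=
    theta_cycleGraph_five_eq_indepNum le_rfl
  have h0 : (0 : ℕ) ∉ {r : ℕ | theta (cycleGraph 5) r = (cycleGraph 5).indepNum} := by
    simp only [Set.mem_setOf_eq]
    intro h
    have hlt := indepNum_lt_theta_zero_cycleGraph_five
    rw [h] at hlt
    exact lt_irrefl _ hlt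
  unfold thetaRank
  refine le_antisymm (Nat.sInf_le h1) (Nat.one_le_iff_ne_zero.2 fun h00 => h0 ?_)
  have hmem := Nat.sInf_mem ⟨1, h1⟩
  rwa [h00] at hmem

/-- **`ϑ^{(α(G)-1)}(G) = α(G)` when `α(G) = χ(Ḡ)`** — the identity predicted by Conjecture 1 of
de Klerk–Pasechnik [cite: LaurentVargas2022, §1 (Conjecture 1 (De Klerk and Pasechnik [dKP2002]):
"For any graph G we have: ϑ^{(α(G)−1)}(G) = α(G)")] [cite: DeklerkPasechnik2002] holds for graphs
with `α(G) = χ(Ḡ)` (rank `0`) [cite: LaurentVargas2022, §1]. -/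
theorem theta_indepNum_pred_of_colorable [Nonempty V] (hc : Gᶜ.Colorable G.indepNum) :
    theta G (G.indepNum - 1) = G.indepNum :=
  theta_eq_indepNum_of_colorable G hc _

/-- **`ϑ^{(α(C₅)-1)}(C₅) = ϑ^{(1)}(C₅) = 2 = α(C₅)`**: the identity predicted by Conjecture 1 holds for
the pentagon [cite: LaurentVargas2022, §1 ("odd cycles and wheels have ϑ-rank 1 and thus satisfy
Conjecture 1 [dKP2002]")] [cite: DeklerkPasechnik2002]. -/
theorem theta_indepNum_pred_cycleGraph_five :
    theta (cycleGraph 5) ((cycleGraph 5).indepNum - 1) = (cycleGraph 5).indepNum := by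
  rw [indepNum_cycleGraph_five]
  exact_mod_cast theta_one_cycleGraph_five

/-- … and it is **tight** for the pentagon: `rank(C₅) = α(C₅) - 1` [cite: LaurentVargas2022, §1
("the conjectured bound α(G) − 1 on rank(G) is tight. As a first example, the cycle C_5 has
α(C_5) = 2 and rank(C_5) = 1")]. -/
theorem thetaRank_cycleGraph_five_eq_indepNum_pred :
    thetaRank (cycleGraph 5) = (cycleGraph 5).indepNum - 1 := by
  rw [thetaRank_cycleGraph_five, indepNum_cycleGraph_five]

end Rank

end Literature.Combinatorics.Optimization.DeKlerkPasechnikThetaRank
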